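import Literature.AlgebraicGeometry.HodgeTheory.GysinHodgeClassLiftProofs
import Literature.AlgebraicGeometry.HodgeTheory.ClassesSupportedOnComplexification
import Literature.AlgebraicGeometry.HodgeTheory.ComplexConjugationHolds
import Literature.AlgebraicGeometry.Motives.HodgeStructureStrictProofs
import Literature.AlgebraicGeometry.Motives.MumfordTateInvariantsLieStabilizer
import Summits.HodgeConjecture.HodgeConjecture.Theses.AmpleAdicLefschetz
import HarnessLib

/-!
# Route AmpleAdicLefschetz · `ThickCodimOne` (stmt-HodgeConjecture-2618) — helper:
# Hodge classes in the image of a pull-back lift to Hodge classes (Voisin 2025, Cor. 2.12 for `f^*`)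

Helper file (`--supports stmt-HodgeConjecture-2618`) for the support item `ThickCodimOne` of
`Summits/HodgeConjecture/HodgeConjecture/Theses/AmpleAdicLefschetz.lean` ("divisor classes on `Y`
in the image of `f^*` come from divisor classes on `X` — Lefschetz `(1,1)` on `X` and `Y` plus the
semisimplicity lift of `ThickNecessary`"). This file proves the LIFT on the tree's carriers, for
every degree `2p` and every morphism `f : Y ⟶ X` of smooth projective complex varieties, in two
forms:

* `span_hodge_inf_range_map_le` — **Hodge classes in the image of `f^*` lift to Hodge classes**:
  a class of `H²ᵖ(Y(ℂ); ℂ)` which is a `ℂ`-combination of rational classes of Hodge type `(p, p)`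
  AND lies in the image of `f^* : H²ᵖ(X(ℂ); ℂ) → H²ᵖ(Y(ℂ); ℂ)` is `f^*` of a `ℂ`-combination of
  rational classes of type `(p, p)` on `X`. Printed source: C. Voisin, *Hodge and generalized
  Hodge conjectures, coniveau and algebraic cycles*, J. Open Math. Probl. 1 (2025), Cor. 2.12
  ("Let `H, H′` be Hodge structures of weight `2k`, with `H′` polarized, and let `φ : H′ → H` be a
  surjective morphism of Hodge structures. Then `φ : Hdg(H′) → Hdg(H)` is surjective"), applied to
  `φ = f^* : H²ᵖ(X, ℚ) → im f^* ⊆ H²ᵖ(Y, ℚ)` — a morphism of Hodge structures (Voisin, *Hodge Theory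
  and Complex Algebraic Geometry I* (2002), §7.3.2) whose image is a sub-Hodge structure (§7.3.1),
  the source being polarised (§7.1.2, Thm. 6.32). The polarisability is the hypothesis `hpol`, the
  body of the named fact `smoothProjective_hodgeStructure_isPolarizable`
  (`HodgeTheory/HodgeRiemannPolarizability`; Hodge–Riemann bilinear relations — "`H′` polarized").
* `span_hodge_inf_range_map_le_of_injective` — the same conclusion WITHOUT polarisability when
  `f^*` is INJECTIVE on `H²ᵖ(X(ℂ); ℂ)` (the weak Lefschetz range of the route): an injective morphism
  of pure Hodge structures of the same weight is strict (Deligne, *Hodge II*, Thm. 2.3.5 (iii); the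
  tree's theorem `HodgeStructure.Hom.strict_holds`), so `F¹`-membership of `f^* u ⊗ 1` forces that of
  `u ⊗ 1`.

Ingredients, all theorems of the tree: the abstract Cor. 2.12
`HodgeStructure.mem_iSup_map_hodgeClasses_of_mem_iSup_range` (`Motives/HodgeStructureDirectSum`,
from the semisimplicity of polarised Hodge structures, `Motives/HodgeStructureSemisimple`) and the
strictness `HodgeStructure.Hom.strict_holds` (`Motives/HodgeStructureStrictProofs`); the `ℚ`-Hodge
structure `HodgeModel.hodgeStructure` of a Hodge symmetric Hodge model on `Hᵏ(X(ℂ); ℚ)` and the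
fact that `f^*` underlies a morphism of these structures, `HodgeModel.hodgeStructureHom`
(`HodgeTheory/HodgeStructureOfHodgeModel`); real (hence Hodge symmetric) Hodge models exist,
`exists_isReal_hodgeModel_holds`; the Hodge pieces do not depend on the model,
`hodgePQ_independent_of_hodgeModel_holds`; universal coefficients `ℂ ⊗ Hᵏ(X(ℂ); ℚ) ≅ Hᵏ(X(ℂ); ℂ)`
for smooth projective `X` (`ofRatClassBaseChange_injective` / `…_surjective`);
finite-dimensionality of `Hᵏ(X(ℂ); ℚ)` (`finite_singularCohomology_rat_complexPoints`).

Also here, proved outright (linear algebra over the flat extension `ℚ ⊆ ℂ`):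
`baseChange_inf_baseChange_le` (`A_ℂ ∩ B_ℂ ⊆ (A ∩ B)_ℂ`), `baseChange_inf_range_le_of_le`
(complexified reading of an inclusion `I ∩ im φ ⊆ φ(J)`), the one-morphism forms of Cor. 2.12
`hodgeClasses_inf_range_le_map` (polarised source) / `…_of_injective` (injective morphism), and
the carrier-level core `span_hodge_inf_range_map_le_of_lift`.

## References

* [Voisin2025] C. Voisin, Hodge and generalized Hodge conjectures, coniveau and algebraic cycles,
  J. Open Math. Probl. 1 (2025) 16–51, Prop. 2.11, Cor. 2.12.
* [VoisinHodgeI2002] C. Voisin, Hodge Theory and Complex Algebraic Geometry I, CUP 2002, §7.1.1,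
  §7.1.2, Lemma 7.26, §7.3.1, §7.3.2.
* [DeligneHodgeII1971] P. Deligne, Théorie de Hodge II, Publ. Math. IHÉS 40 (1971), Thm. 2.3.5.
* [Deligne2000] P. Deligne, The Hodge conjecture (Clay, 2000), §1.
-/

noncomputable section

-- `Summit.HodgeConjecture.HodgeConjecture.Theorems` is the mandated namespace (single-problem summit:
-- Problem = Summit), which `linter.dupNamespace` flags; the lakefile turns the linter off tree-wide
-- (weak option), restated here so stand-alone elaboration is warning-free too.
set_option linter.dupNamespace false

namespace Summit.HodgeConjecture.HodgeConjecture.Theorems.AmpleAdicLefschetz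

open CategoryTheory AlgebraicGeometry
open scoped TensorProduct
open Literature.AlgebraicGeometry Literature.AlgebraicGeometry.Motives
open Literature.AlgebraicGeometry.HodgeTheory
open Literature.AlgebraicTopology.SingularHomology

/-! ### Linear algebra: complexification commutes with intersections -/

section LinearAlgebra

universe u v

variable {M : Type u} [AddCommGroup M] [Module ℚ M] {N : Type v} [AddCommGroup N] [Module ℚ N]

/-- **Complexification commutes with intersections** of `ℚ`-subspaces: `A_ℂ ∩ B_ℂ ⊆ (A ∩ B)_ℂ`
inside `ℂ ⊗_ℚ M` (the reverse inclusion being trivial). An element of `A_ℂ` is killed by the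
complexified quotient map `M → M ⧸ A`, likewise for `B`, and `A ∩ B = ker (M → M ⧸ A) ∩ ker (M → M ⧸ B)`;
apply the tree's `mem_baseChange_iInf_ker` (`ℂ` is free, hence flat, over `ℚ`) to the pair of
quotient maps. -/
theorem baseChange_inf_baseChange_le (A B : Submodule ℚ M) :
    A.baseChange ℂ ⊓ B.baseChange ℂ ≤ (A ⊓ B).baseChange ℂ := by
  -- an element of `P_ℂ` dies in `(M ⧸ P)_ℂ`
  have hkill : ∀ (P : Submodule ℚ M) {x : ℂ ⊗[ℚ] M}, x ∈ P.baseChange ℂ →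
      P.mkQ.baseChange ℂ x = 0 := by
    intro P x hx
    obtain ⟨t, rfl⟩ : x ∈ LinearMap.range (P.subtype.baseChange ℂ) := hx
    have h0 : P.mkQ ∘ₗ P.subtype = 0 := LinearMap.ext fun y ↦ by simp
    rw [← LinearMap.comp_apply, ← LinearMap.baseChange_comp, h0, LinearMap.baseChange_zero,
      LinearMap.zero_apply]
  rintro x ⟨hxA, hxB⟩
  have key := mem_baseChange_iInf_ker (N := fun b : Bool ↦ M ⧸ cond b A B)
    (fun b : Bool ↦ (cond b A B).mkQ) (ξ := x) fun b ↦ by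
      cases b
      · exact hkill B hxB
      · exact hkill A hxA
  have e : (⨅ b : Bool, LinearMap.ker (cond b A B).mkQ) = A ⊓ B := by
    rw [iInf_bool_eq]
    simp only [Bool.cond_true, Bool.cond_false, Submodule.ker_mkQ]
  rwa [e] at key

/-- **Complexified reading of an inclusion `I ∩ im φ ⊆ φ(J)`**: for a `ℚ`-linear `φ : N → M` and
`ℚ`-subspaces `I ⊆ M`, `J ⊆ N` with `I ∩ im φ ⊆ φ(J)`, one has `I_ℂ ∩ im φ_ℂ ⊆ φ_ℂ(J_ℂ)` in
`ℂ ⊗_ℚ M` — `im φ_ℂ = (im φ)_ℂ`, `I_ℂ ∩ (im φ)_ℂ ⊆ (I ∩ im φ)_ℂ`, and `(φ(J))_ℂ = φ_ℂ(J_ℂ)`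
(`ℂ ⊗ –` is exact over the field `ℚ`). -/
theorem baseChange_inf_range_le_of_le (φ : N →ₗ[ℚ] M) {I : Submodule ℚ M} {J : Submodule ℚ N}
    (h : I ⊓ LinearMap.range φ ≤ J.map φ) :
    I.baseChange ℂ ⊓ LinearMap.range (φ.baseChange ℂ) ≤ (J.baseChange ℂ).map (φ.baseChange ℂ) := by
  rw [HodgeStructure.range_baseChange, ← HodgeStructure.baseChange_map]
  exact (baseChange_inf_baseChange_le _ _).trans (Submodule.baseChange_mono ℂ h)

end LinearAlgebra

/-! ### Cor. 2.12 for one morphism of Hodge structures; the injective case by strictness -/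

section HodgeStructures

universe u v

variable {V : Type u} [AddCommGroup V] [Module ℚ V] {V' : Type v} [AddCommGroup V'] [Module ℚ V']
  {n : ℤ}

/-- **Hodge classes in the image of a morphism from a polarised Hodge structure lift to Hodge
classes** (Voisin 2025, Cor. 2.12, for the morphism `φ : H′ → im φ ⊆ H`): for Hodge structures
`H′` (finite-dimensional, polarisable) and `H` of weight `n = k + k` and a morphism `φ : H′ → H`,
`Hdgᵏ(H) ∩ im φ ⊆ φ(Hdgᵏ(H′))`. The one-member case of the tree's
`HodgeStructure.mem_iSup_map_hodgeClasses_of_mem_iSup_range`. -/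
theorem hodgeClasses_inf_range_le_map [Module.Finite ℚ V'] {H' : HodgeStructure V' n}
    {H : HodgeStructure V n} (φ : HodgeStructure.Hom H' H) (hH' : H'.IsPolarizable) {k : ℤ}
    (hk : k + k = n) :
    H.hodgeClasses k ⊓ LinearMap.range φ.toLinearMap ≤ (H'.hodgeClasses k).map φ.toLinearMap := by
  rintro v ⟨hv, hv'⟩
  have h := HodgeStructure.mem_iSup_map_hodgeClasses_of_mem_iSup_range (ι := Unit)
    (H' := fun _ ↦ H') (fun _ ↦ hH') (H := H) (fun _ ↦ φ) hk hv (by rwa [iSup_const])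
  rwa [iSup_const] at h

/-- **Hodge classes in the image of an INJECTIVE morphism of Hodge structures lift to Hodge
classes**, with no polarisation: for `φ : H′ → H` with `φ` injective and `v = φ u ∈ Hdgᵏ(H)`,
`u ∈ Hdgᵏ(H′)`. Indeed `φ_ℂ (u ⊗ 1) = v ⊗ 1 ∈ Fᵏ H ∩ im φ_ℂ = φ_ℂ(Fᵏ H′)` by the strictness of
morphisms of pure Hodge structures (Deligne, Hodge II, Thm. 2.3.5 (iii); the tree's
`HodgeStructure.Hom.strict_holds`), and `φ_ℂ` is injective (`ℂ` flat over `ℚ`). -/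
theorem hodgeClasses_inf_range_le_map_of_injective {H' : HodgeStructure V' n}
    {H : HodgeStructure V n} (φ : HodgeStructure.Hom H' H)
    (hφ : Function.Injective φ.toLinearMap) (k : ℤ) :
    H.hodgeClasses k ⊓ LinearMap.range φ.toLinearMap ≤ (H'.hodgeClasses k).map φ.toLinearMap := by
  rintro v ⟨hv, u, rfl⟩
  refine ⟨u, ?_, rfl⟩
  rw [SetLike.mem_coe, HodgeStructure.mem_hodgeClasses_iff] at hv ⊢
  have hmem : HodgeStructure.ofRat (φ.toLinearMap u) ∈
      (H'.F k).map (φ.toLinearMap.baseChange ℂ) := by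
    rw [HodgeStructure.Hom.strict_holds φ k]
    exact ⟨hv, HodgeStructure.ofRat u, HodgeStructure.baseChange_ofRat _ _⟩
  obtain ⟨w, hw, hwe⟩ := hmem
  rw [← HodgeStructure.baseChange_ofRat] at hwe
  rw [← HodgeStructure.baseChange_injective_of_injective hφ hwe]
  exact hw

end HodgeStructures

/-! ### On the tree's carriers: Hodge classes in the image of `f^*` lift to Hodge classes -/

section Carriers

variable {n m : ℕ} {X Y : SchemeOver ℂ}

/-- **Core of the carrier-level lift.** Let `f : Y ⟶ X` be a morphism of smooth projective
complex varieties of dimensions `m`, `n`, and `p : ℕ`. Suppose that for all Hodge symmetric Hodge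
models `A` of `X` and `B` of `Y`, the morphism of Hodge structures
`φ = HodgeModel.hodgeStructureHom … f (2p) : H^{2p}(X(ℂ); ℚ) → H^{2p}(Y(ℂ); ℚ)` underlying `f^*`
(Voisin I §7.3.2) satisfies `Hdgᵖ(Y) ∩ im φ ⊆ φ(Hdgᵖ(X))` (hypothesis `hlift`). Then a class of
`H²ᵖ(Y(ℂ); ℂ)` in the `ℂ`-span of the rational classes of Hodge type `(p, p)` which lies in the
image of `f^* : H²ᵖ(X(ℂ); ℂ) → H²ᵖ(Y(ℂ); ℂ)` is `f^* a` for some `a` in the `ℂ`-span of the rational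
classes of type `(p, p)` of `X`. Proof: read everything in `ℂ ⊗ H²ᵖ(–(ℂ); ℚ)` through the
universal-coefficient maps `β` (injective, and onto for smooth projective varieties), where the
span of the rational `(p,p)`-classes is `β` of the complexification of `Hdgᵖ` of the Hodge
structure of a real Hodge model (`HodgeModel.mem_hodgeClasses_iff_isOfHodgeType`) and `f^* ∘ β_X`
is `β_Y ∘ (φ ⊗ ℂ)`; then apply the complexified reading of `hlift`
(`baseChange_inf_range_le_of_le`). -/
theorem span_hodge_inf_range_map_le_of_lift (hX : IsSmoothProjective n X)
    (hY : IsSmoothProjective m Y) (f : Y ⟶ X) (p : ℕ)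
    (hlift : ∀ (A : HodgeModel n X) (B : HodgeModel m Y) (hA : A.IsHodgeSymmetric)
      (hB : B.IsHodgeSymmetric),
      (B.hodgeStructure hY hB (2 * p)).hodgeClasses p ⊓ LinearMap.range
          (A.hodgeStructureHom hX hodgePQ_independent_of_hodgeModel_holds hA B hY hB f
            (2 * p)).toLinearMap ≤
        ((A.hodgeStructure hX hA (2 * p)).hodgeClasses p).map
          (A.hodgeStructureHom hX hodgePQ_independent_of_hodgeModel_holds hA B hY hB f
            (2 * p)).toLinearMap) :
    Submodule.span ℂ {b : complexBetti Y (2 * p) |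
        IsRationalClass b ∧ IsOfHodgeType m Y (2 * p) p p b} ⊓
        LinearMap.range (complexBetti.map f (2 * p)).hom ≤
      (Submodule.span ℂ {a : complexBetti X (2 * p) |
          IsRationalClass a ∧ IsOfHodgeType n X (2 * p) p p a}).map (complexBetti.map f (2 * p)).hom := by
  classical
  -- real (hence Hodge symmetric) Hodge models, and the Hodge structures on `H^{2p}(–(ℂ); ℚ)`
  obtain ⟨A, hAr⟩ := exists_isReal_hodgeModel_holds n X hX
  obtain ⟨B, hBr⟩ := exists_isReal_hodgeModel_holds m Y hY
  have hA : A.IsHodgeSymmetric := hAr.isHodgeSymmetric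
  have hB : B.IsHodgeSymmetric := hBr.isHodgeSymmetric
  have hI : hodgePQ_independent_of_hodgeModel := hodgePQ_independent_of_hodgeModel_holds
  -- `f^*` on `H^{2p}(–(ℂ); ℚ)` is a morphism of these Hodge structures (Voisin I §7.3.2)
  let φ := A.hodgeStructureHom hX hodgePQ_independent_of_hodgeModel_holds hA B hY hB f (2 * p)
  -- naturality of the complexification `β`: `β_Y ∘ (f^* ⊗ ℂ) = f^* ∘ β_X`
  have hnat : ∀ t, ofRatClassBaseChange (ComplexPoints Y) (2 * p) (φ.toLinearMap.baseChange ℂ t) =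
      (complexBetti.map f (2 * p)).hom (ofRatClassBaseChange (ComplexPoints X) (2 * p) t) :=
    fun t ↦ HodgeModel.ofRatClassBaseChange_baseChange_map f (2 * p) t
  -- the span of the rational `(p,p)`-classes of `Y` is `β_Y ((Hdgᵖ)_ℂ)`
  have hSY : Submodule.span ℂ {b : complexBetti Y (2 * p) |
        IsRationalClass b ∧ IsOfHodgeType m Y (2 * p) p p b} ≤
      (((B.hodgeStructure hY hB (2 * p)).hodgeClasses p).baseChange ℂ).map
        (ofRatClassBaseChange (ComplexPoints Y) (2 * p)) := by
    rw [Submodule.span_le]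
    rintro b ⟨hb, hb'⟩
    obtain ⟨y, rfl⟩ := (isRationalClass_iff_mem_range_ofRatClass b).1 hb
    refine ⟨HodgeStructure.ofRat y, ?_, ofRatClassBaseChange_ofRat (a := y)⟩
    rw [HodgeStructure.ofRat_apply]
    exact Submodule.tmul_mem_baseChange_of_mem 1
      ((B.mem_hodgeClasses_iff_isOfHodgeType hY hI hB p y).2 hb')
  -- `β_X ((Hdgᵖ)_ℂ)` lies in the span of the rational `(p,p)`-classes of `X`
  have hSX : (((A.hodgeStructure hX hA (2 * p)).hodgeClasses p).baseChange ℂ).map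
        (ofRatClassBaseChange (ComplexPoints X) (2 * p)) ≤
      Submodule.span ℂ {a : complexBetti X (2 * p) |
        IsRationalClass a ∧ IsOfHodgeType n X (2 * p) p p a} := by
    rw [Submodule.baseChange_eq_span, Submodule.map_span, Submodule.span_le]
    rintro _ ⟨_, ⟨h, hh, rfl⟩, rfl⟩
    rw [TensorProduct.mk_apply, ofRatClassBaseChange_tmul, one_smul]
    exact Submodule.subset_span
      ⟨isRationalClass_ofRatClass h, A.isOfHodgeType_of_mem_hodgeClasses hX hA hh⟩
  -- the class: `c = f^* a₀`, `a₀ = β_X t₀`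
  rintro c ⟨hc, a₀, rfl⟩
  obtain ⟨t₀, rfl⟩ := ofRatClassBaseChange_surjective hX (2 * p) a₀
  -- `s := (f^* ⊗ ℂ) t₀` lies in `(Hdgᵖ(Y))_ℂ`: `β_Y s = c` lies in `β_Y ((Hdgᵖ(Y))_ℂ)`, `β_Y` injective
  have hs : φ.toLinearMap.baseChange ℂ t₀ ∈
      ((B.hodgeStructure hY hB (2 * p)).hodgeClasses p).baseChange ℂ := by
    obtain ⟨s', hs', hs'eq⟩ := hSY hc
    rw [← hnat t₀] at hs'eq
    rw [← ofRatClassBaseChange_injective _ _ hs'eq]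
    exact hs'
  -- the lift: `s = (f^* ⊗ ℂ) t` with `t ∈ (Hdgᵖ(X))_ℂ`
  obtain ⟨t, ht, hts⟩ :=
    baseChange_inf_range_le_of_le φ.toLinearMap (hlift A B hA hB) ⟨hs, t₀, rfl⟩
  refine ⟨ofRatClassBaseChange (ComplexPoints X) (2 * p) t, hSX ⟨t, ht, rfl⟩, ?_⟩
  rw [← hnat t, ← hnat t₀, hts]

/-- **Hodge classes in the image of a pull-back lift to Hodge classes** (Voisin 2025, Cor. 2.12
applied to `f^*`; Voisin I §7.3.2: `f^*` is a morphism of Hodge structures; "`H′` polarized" is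
the hypothesis `hpol`, the body of the named fact `smoothProjective_hodgeStructure_isPolarizable`,
Voisin I Thm. 6.32 / §7.1.2). For a morphism `f : Y ⟶ X` of smooth projective complex varieties of
dimensions `m`, `n` and any `p`: a class of `H²ᵖ(Y(ℂ); ℂ)` in the `ℂ`-span of the rational classes
of Hodge type `(p, p)` which lies in the image of `f^* : H²ᵖ(X(ℂ); ℂ) → H²ᵖ(Y(ℂ); ℂ)` is `f^* a`
for some `a` in the `ℂ`-span of the rational classes of type `(p, p)` of `X`
(`span_hodge_inf_range_map_le_of_lift` with `hodgeClasses_inf_range_le_map`; `H²ᵖ(X(ℂ); ℚ)` is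
finite-dimensional, `finite_singularCohomology_rat_complexPoints`). -/
theorem span_hodge_inf_range_map_le
    (hpol : ∀ ⦃m : ℕ⦄ ⦃Y : SchemeOver ℂ⦄ (hY : IsSmoothProjective m Y) (A : HodgeModel m Y)
      (hA : A.IsHodgeSymmetric) (k : ℕ), (A.hodgeStructure hY hA k).IsPolarizable)
    (hX : IsSmoothProjective n X) (hY : IsSmoothProjective m Y) (f : Y ⟶ X) (p : ℕ) :
    Submodule.span ℂ {b : complexBetti Y (2 * p) |
        IsRationalClass b ∧ IsOfHodgeType m Y (2 * p) p p b} ⊓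
        LinearMap.range (complexBetti.map f (2 * p)).hom ≤
      (Submodule.span ℂ {a : complexBetti X (2 * p) |
          IsRationalClass a ∧ IsOfHodgeType n X (2 * p) p p a}).map (complexBetti.map f (2 * p)).hom := by
  haveI : Module.Finite ℚ (singularCohomology ℚ ℚ (ComplexPoints X) (2 * p)) :=
    finite_singularCohomology_rat_complexPoints hX _
  exact span_hodge_inf_range_map_le_of_lift hX hY f p fun A B hA hB ↦
    hodgeClasses_inf_range_le_map _ (hpol hX A hA (2 * p)) (by push_cast; ring)

/-- `f^*` injective on `H^{2p}(X(ℂ); ℂ)` is injective on `H^{2p}(X(ℂ); ℚ)`: the rational lattice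
maps `Hᵏ(–(ℂ); ℚ) → Hᵏ(–(ℂ); ℂ)` are injective and commute with pull-backs (`ofRatClass_map`). -/
theorem injective_map_rat_of_injective_map (f : Y ⟶ X) (k : ℕ)
    (hf : Function.Injective (complexBetti.map f k).hom) :
    Function.Injective
      (singularCohomology.map ℚ ℚ (AlgPoints.mapContinuous (L := ℂ) f) k).hom := by
  intro u u' h
  apply ofRatClass_injective (Y := ComplexPoints X) k
  apply hf
  change complexBetti.map f k (ofRatClass (ComplexPoints X) k u) =
    complexBetti.map f k (ofRatClass (ComplexPoints X) k u')
  rw [complexBetti.map, ← ofRatClass_map, ← ofRatClass_map]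
  exact congrArg _ h

/-- **Hodge classes in the image of an INJECTIVE pull-back lift to Hodge classes, with no
polarisation** (the weak Lefschetz range of the route: `f^* : H²ᵖ(X(ℂ); ℂ) → H²ᵖ(Y(ℂ); ℂ)`
injective). For a morphism `f : Y ⟶ X` of smooth projective complex varieties with `f^*` injective
in degree `2p`: a `ℂ`-combination of rational `(p,p)`-classes of `Y` lying in `im f^*` is `f^* a`
for a `ℂ`-combination `a` of rational `(p,p)`-classes of `X`
(`span_hodge_inf_range_map_le_of_lift` with `hodgeClasses_inf_range_le_map_of_injective`:
strictness of morphisms of pure Hodge structures, Deligne, Hodge II, Thm. 2.3.5 (iii)). -/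
theorem span_hodge_inf_range_map_le_of_injective (hX : IsSmoothProjective n X)
    (hY : IsSmoothProjective m Y) (f : Y ⟶ X) (p : ℕ)
    (hf : Function.Injective (complexBetti.map f (2 * p)).hom) :
    Submodule.span ℂ {b : complexBetti Y (2 * p) |
        IsRationalClass b ∧ IsOfHodgeType m Y (2 * p) p p b} ⊓
        LinearMap.range (complexBetti.map f (2 * p)).hom ≤
      (Submodule.span ℂ {a : complexBetti X (2 * p) |
          IsRationalClass a ∧ IsOfHodgeType n X (2 * p) p p a}).map (complexBetti.map f (2 * p)).hom :=
  span_hodge_inf_range_map_le_of_lift hX hY f p fun _ _ _ _ ↦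
    hodgeClasses_inf_range_le_map_of_injective _ (injective_map_rat_of_injective_map f (2 * p) hf) _

/-- **The polarised lift, one class at a time**: a `ℂ`-combination `c` of rational
`(p,p)`-classes of `Y` of the form `c = f^* a₀` is `f^* a` for a `ℂ`-combination `a` of rational
`(p,p)`-classes of `X` (Voisin 2025, Cor. 2.12 for `f^*`, granted the polarisability `hpol`). -/
theorem exists_mem_span_hodge_map_eq
    (hpol : ∀ ⦃m : ℕ⦄ ⦃Y : SchemeOver ℂ⦄ (hY : IsSmoothProjective m Y) (A : HodgeModel m Y)
      (hA : A.IsHodgeSymmetric) (k : ℕ), (A.hodgeStructure hY hA k).IsPolarizable)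
    (hX : IsSmoothProjective n X) (hY : IsSmoothProjective m Y) (f : Y ⟶ X) {p : ℕ}
    {c : complexBetti Y (2 * p)}
    (hc : c ∈ Submodule.span ℂ {b : complexBetti Y (2 * p) |
      IsRationalClass b ∧ IsOfHodgeType m Y (2 * p) p p b})
    (hcf : c ∈ LinearMap.range (complexBetti.map f (2 * p)).hom) :
    ∃ a ∈ Submodule.span ℂ {a : complexBetti X (2 * p) |
        IsRationalClass a ∧ IsOfHodgeType n X (2 * p) p p a},
      complexBetti.map f (2 * p) a = c := by
  obtain ⟨a, ha, hac⟩ := span_hodge_inf_range_map_le hpol hX hY f p ⟨hc, hcf⟩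
  exact ⟨a, ha, hac⟩

/-- **The injective lift, one class at a time**: with `f^*` injective in degree `2p`, a
`ℂ`-combination `c` of rational `(p,p)`-classes of `Y` of the form `c = f^* a₀` is `f^* a` for a
`ℂ`-combination `a` of rational `(p,p)`-classes of `X` (strictness; no polarisation). -/
theorem exists_mem_span_hodge_map_eq_of_injective (hX : IsSmoothProjective n X)
    (hY : IsSmoothProjective m Y) (f : Y ⟶ X) {p : ℕ}
    (hf : Function.Injective (complexBetti.map f (2 * p)).hom) {c : complexBetti Y (2 * p)}
    (hc : c ∈ Submodule.span ℂ {b : complexBetti Y (2 * p) |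
      IsRationalClass b ∧ IsOfHodgeType m Y (2 * p) p p b})
    (hcf : c ∈ LinearMap.range (complexBetti.map f (2 * p)).hom) :
    ∃ a ∈ Submodule.span ℂ {a : complexBetti X (2 * p) |
        IsRationalClass a ∧ IsOfHodgeType n X (2 * p) p p a},
      complexBetti.map f (2 * p) a = c := by
  obtain ⟨a, ha, hac⟩ := span_hodge_inf_range_map_le_of_injective hX hY f p hf ⟨hc, hcf⟩
  exact ⟨a, ha, hac⟩

end Carriers

end Summit.HodgeConjecture.HodgeConjecture.Theorems.AmpleAdicLefschetz

end
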